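import Summits.QuantumAdvantage.QuantumAdvantage.Theorems.HankelLiftBeyondRectanglesForsterCore
import Literature.Computability.Complexity.ForsterIsotropicPosition

/-!
# Forster's theorem from radial isotropic position (Forster 2002, Thm 2.2 ⟸ Thm 4.1)

Route `route-QuantumAdvantage-HankelLift`; infrastructure for the sign-rank rung of the open crux
`HankelLift.BeyondRectangles` (stmt-QuantumAdvantage-18440).  The rung is conditional on the named
fact `Literature.Computability.Complexity.ForsterHalfspaceBound` (Forster's Theorem 2.2).  Here that
fact is REDUCED, with a complete proof, to the linear-algebra core of Forster's paper, his
Theorem 4.1 (`ForsterIsotropicPosition`, a named fact: vectors in general position can be brought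
into radial isotropic position by a nonsingular linear map): Forster's own three-step proof —
perturb to general position (`Forster.exists_generalPosition`), rescale by Theorem 4.1 and
normalize (`A u_x/‖A u_x‖`, `A⁻ᵀ v_y/‖A⁻ᵀ v_y‖`, signs preserved), then Lemma 2.1 and the count
(`Forster.forster_count`).

* `ForsterIsotropicPosition` — Forster's Theorem 4.1 (named fact, NOT proved).
* `halfspaceBound_fin_of_isotropicPosition` — the bound `√(|X||Y|) ≤ B·k` for arrangements in
  `ℝ^k = Fin k → ℝ`, from the fact.
* `halfspaceBound_of_isotropicPosition` — the same for an arbitrary finite coordinate type `ι`;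
  its conclusion is verbatim the body of `Literature.Computability.Complexity.ForsterHalfspaceBound`
  (the one-line corollary `ForsterIsotropicPosition → ForsterHalfspaceBound` is filed separately,
  once that Literature module is in the tree).
[cite: Forster2002, Theorem 2.2, Theorem 4.1]
-/

set_option linter.dupNamespace false -- D-0017: single-problem summit ⇒ `QuantumAdvantage.QuantumAdvantage` by design

noncomputable section

namespace Summit.QuantumAdvantage.QuantumAdvantage.Theorems.HankelLift.Forster

open Finset Real Matrix

/-- `√|Y| ≤ B` from the bilinear bound, for `X` nonempty (test vectors `e_{x₀}` and the row
`M_{x₀,·}`). [folklore] -/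
theorem sqrt_card_le_of_bilinear {X Y : Type*} [Fintype X] [Fintype Y] [DecidableEq X]
    (M : X → Y → ℝ) {B : ℝ} (hB0 : 0 ≤ B) (hM : ∀ x y, M x y = 1 ∨ M x y = -1)
    (hB : ∀ (a : X → ℝ) (b : Y → ℝ),
      |∑ x, ∑ y, a x * M x y * b y| ≤ B * Real.sqrt (∑ x, a x ^ 2) * Real.sqrt (∑ y, b y ^ 2))
    (x₀ : X) : Real.sqrt (Fintype.card Y : ℝ) ≤ B := by
  have hsq : ∀ y, M x₀ y ^ 2 = 1 := fun y => by rcases hM x₀ y with h | h <;> simp [h]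
  have h := hB (Pi.single x₀ 1) (M x₀)
  have hlhs : ∑ x, ∑ y, (Pi.single x₀ (1 : ℝ) : X → ℝ) x * M x y * M x₀ y =
      (Fintype.card Y : ℝ) := by
    rw [Finset.sum_eq_single x₀]
    · simp only [Pi.single_eq_same, one_mul]
      rw [Finset.sum_congr rfl fun y _ => by rw [← sq, hsq y], Finset.sum_const, Finset.card_univ,
        nsmul_eq_mul, mul_one]
    · intro x _ hx; simp [Pi.single_eq_of_ne hx]
    · intro h; exact absurd (Finset.mem_univ _) h
  have ha : ∑ x, (Pi.single x₀ (1 : ℝ) : X → ℝ) x ^ 2 = 1 := by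
    rw [Finset.sum_eq_single x₀]
    · simp
    · intro x _ hx; simp [Pi.single_eq_of_ne hx]
    · intro h; exact absurd (Finset.mem_univ _) h
  have hb : ∑ y, M x₀ y ^ 2 = (Fintype.card Y : ℝ) := by
    rw [Finset.sum_congr rfl fun y _ => hsq y, Finset.sum_const, Finset.card_univ, nsmul_eq_mul,
      mul_one]
  rw [hlhs, ha, hb, Real.sqrt_one, mul_one] at h
  have hY0 : (0 : ℝ) ≤ Fintype.card Y := Nat.cast_nonneg _
  have h' : Real.sqrt (Fintype.card Y : ℝ) * Real.sqrt (Fintype.card Y : ℝ) ≤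
      B * Real.sqrt (Fintype.card Y : ℝ) := by
    rw [Real.mul_self_sqrt hY0]; exact (le_abs_self _).trans h
  rcases eq_or_lt_of_le (Real.sqrt_nonneg (Fintype.card Y : ℝ)) with h0 | hpos
  · rw [← h0]; exact hB0
  · exact le_of_mul_le_mul_right h' hpos

/-- `√n ≤ n` for a natural number `n ≥ 1`. [folklore] -/
theorem sqrt_natCast_le_self {n : ℕ} (hn : 1 ≤ n) : Real.sqrt (n : ℝ) ≤ n := by
  have h1 : (1 : ℝ) ≤ n := by exact_mod_cast hn
  rw [Real.sqrt_le_left (by linarith)]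
  nlinarith

/-- **Forster's Theorem 2.2 in `ℝ^k`, from Theorem 4.1.**  If `u_x, v_y : Fin k → ℝ` realize the
`±1` matrix `M` (`M_{xy}⟨u_x,v_y⟩ > 0`) and `M` has the bilinear bound `B ≥ 0`, then
`√(|X|·|Y|) ≤ B·k`.  Proof (Forster): trivial if `|X| < k` (`B ≥ √|Y|`); otherwise perturb `u` into
general position keeping the signs (`exists_generalPosition`, margin `m = min M⟨u,v⟩ > 0`), apply
Theorem 4.1 to get `A`, pass to the unit vectors `A u_x/‖A u_x‖` and `A⁻ᵀ v_y/‖A⁻ᵀ v_y‖`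
(`⟨A u, A⁻ᵀ v⟩ = ⟨u, v⟩`), and conclude with `forster_count`. [cite: Forster2002, Theorem 2.2] -/
theorem halfspaceBound_fin_of_isotropicPosition (hI : Literature.Computability.Complexity.ForsterIsotropicPosition)
    {X Y : Type} [Fintype X] [Fintype Y] {k : ℕ} (M : X → Y → ℝ) (u : X → Fin k → ℝ)
    (v : Y → Fin k → ℝ) {B : ℝ} (hB0 : 0 ≤ B) (hM : ∀ x y, M x y = 1 ∨ M x y = -1)
    (hsign : ∀ x y, 0 < M x y * ∑ l, u x l * v y l)
    (hB : ∀ (a : X → ℝ) (b : Y → ℝ),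
      |∑ x, ∑ y, a x * M x y * b y| ≤ B * Real.sqrt (∑ x, a x ^ 2) * Real.sqrt (∑ y, b y ^ 2)) :
    Real.sqrt ((Fintype.card X : ℝ) * (Fintype.card Y : ℝ)) ≤ B * k := by
  classical
  -- empty cases
  rcases isEmpty_or_nonempty X with hX | hX
  · have : (Fintype.card X : ℝ) = 0 := by simp
    rw [this, zero_mul, Real.sqrt_zero]; positivity
  rcases isEmpty_or_nonempty Y with hY | hY
  · have : (Fintype.card Y : ℝ) = 0 := by simp
    rw [this, mul_zero, Real.sqrt_zero]; positivity
  obtain ⟨x₀⟩ := hX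
  obtain ⟨y₀⟩ := hY
  have hBY : Real.sqrt (Fintype.card Y : ℝ) ≤ B := sqrt_card_le_of_bilinear M hB0 hM hB x₀
  -- `k ≥ 1`
  have hk : 1 ≤ k := by
    rcases Nat.eq_zero_or_pos k with h0 | h0
    · subst h0
      have := hsign x₀ y₀
      simp at this
    · exact h0
  have hkpos : (0 : ℝ) < k := by exact_mod_cast hk
  by_cases hXk : Fintype.card X < k
  · -- trivial case `|X| < k`
    have hX1 : 1 ≤ Fintype.card X := Fintype.card_pos_iff.mpr ⟨x₀⟩
    have hXk' : (Fintype.card X : ℝ) ≤ k := by exact_mod_cast hXk.le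
    calc Real.sqrt ((Fintype.card X : ℝ) * (Fintype.card Y : ℝ))
        = Real.sqrt (Fintype.card X : ℝ) * Real.sqrt (Fintype.card Y : ℝ) :=
          Real.sqrt_mul (Nat.cast_nonneg _) _
      _ ≤ (Fintype.card X : ℝ) * B :=
          mul_le_mul (sqrt_natCast_le_self hX1) hBY (Real.sqrt_nonneg _) (Nat.cast_nonneg _)
      _ ≤ k * B := mul_le_mul_of_nonneg_right hXk' hB0
      _ = B * k := mul_comm _ _
  push Not at hXk
  -- the margin `m` and the perturbation size `ε`
  obtain ⟨p₀, -, hp₀⟩ := Finset.exists_min_image Finset.univ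
    (fun p : X × Y => M p.1 p.2 * ∑ l, u p.1 l * v p.2 l) ⟨(x₀, y₀), Finset.mem_univ _⟩
  set m : ℝ := M p₀.1 p₀.2 * ∑ l, u p₀.1 l * v p₀.2 l with hmdef
  have hm : 0 < m := hsign _ _
  have hmle : ∀ x y, m ≤ M x y * ∑ l, u x l * v y l := fun x y => hp₀ (x, y) (Finset.mem_univ _)
  set V : ℝ := ∑ y, ∑ l, |v y l| with hVdef
  have hV0 : 0 ≤ V := Finset.sum_nonneg fun y _ => Finset.sum_nonneg fun l _ => abs_nonneg _
  set ε : ℝ := m / (V + 1) with hεdef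
  have hε : 0 < ε := by positivity
  obtain ⟨u', hu', hli⟩ := exists_generalPosition u hε
  -- the signs are preserved
  have hsign' : ∀ x y, 0 < M x y * ∑ l, u' x l * v y l := by
    intro x y
    have hdiff : |∑ l, u' x l * v y l - ∑ l, u x l * v y l| ≤ ε * V := by
      rw [← Finset.sum_sub_distrib]
      calc |∑ l, (u' x l * v y l - u x l * v y l)|
          ≤ ∑ l, |u' x l * v y l - u x l * v y l| := Finset.abs_sum_le_sum_abs _ _
        _ = ∑ l, |u' x l - u x l| * |v y l| :=
            Finset.sum_congr rfl fun l _ => by rw [← sub_mul, abs_mul]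
        _ ≤ ∑ l, ε * |v y l| :=
            Finset.sum_le_sum fun l _ => mul_le_mul_of_nonneg_right (hu' x l) (abs_nonneg _)
        _ = ε * ∑ l, |v y l| := by rw [Finset.mul_sum]
        _ ≤ ε * V := mul_le_mul_of_nonneg_left
            (Finset.single_le_sum (f := fun y => ∑ l, |v y l|)
              (fun y _ => Finset.sum_nonneg fun l _ => abs_nonneg _) (Finset.mem_univ y)) hε.le
    have hMabs : |M x y| = 1 := by rcases hM x y with h | h <;> simp [h]
    have h2 : |M x y * (∑ l, u' x l * v y l - ∑ l, u x l * v y l)| ≤ ε * V := by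
      rw [abs_mul, hMabs, one_mul]; exact hdiff
    have h3 := neg_abs_le (M x y * (∑ l, u' x l * v y l - ∑ l, u x l * v y l))
    have hεV : ε * V < m := by
      rw [hεdef, div_mul_eq_mul_div, div_lt_iff₀ (by positivity)]
      nlinarith
    have h4 := hmle x y
    nlinarith
  -- Theorem 4.1
  obtain ⟨A, hA, hiso⟩ := hI X k u' hXk hli
  have hAunit : IsUnit A := (Matrix.isUnit_iff_isUnit_det A).mpr hA
  -- the new vectors
  set Au : X → Fin k → ℝ := fun x => A *ᵥ u' x with hAudef
  set Bv : Y → Fin k → ℝ := fun y => v y ᵥ* A⁻¹ with hBvdef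
  have hkey : ∀ x y, Au x ⬝ᵥ Bv y = ∑ l, u' x l * v y l := by
    intro x y
    simp only [hAudef, hBvdef]
    rw [dotProduct_comm, dotProduct_mulVec, vecMul_vecMul, Matrix.nonsing_inv_mul A hA, vecMul_one,
      dotProduct_comm]
    rfl
  have hu'ne : ∀ x, u' x ≠ 0 := by
    intro x
    have h := hli {x} (by simp; exact hk)
    rw [Finset.coe_singleton] at h
    exact h.ne_zero (Set.mem_singleton x)
  have hvne : ∀ y, v y ≠ 0 := by
    intro y hzero
    have := hsign x₀ y
    rw [hzero] at this
    simp at this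
  have hAune : ∀ x, Au x ≠ 0 := by
    intro x h
    apply hu'ne x
    have hinj := Matrix.mulVec_injective_iff_isUnit.mpr hAunit
    exact hinj (h.trans (Matrix.mulVec_zero A).symm)
  have hBvne : ∀ y, Bv y ≠ 0 := by
    intro y h
    apply hvne y
    have : v y = (v y ᵥ* A⁻¹) ᵥ* A := by
      rw [vecMul_vecMul, Matrix.nonsing_inv_mul A hA, vecMul_one]
    rw [this]
    change Bv y ᵥ* A = 0
    rw [h, Matrix.zero_vecMul]
  -- norms
  have hnn : ∀ w : Fin k → ℝ, 0 ≤ w ⬝ᵥ w := fun w =>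
    Finset.sum_nonneg fun l _ => mul_self_nonneg _
  have hpos : ∀ w : Fin k → ℝ, w ≠ 0 → 0 < w ⬝ᵥ w := fun w hw =>
    lt_of_le_of_ne (hnn w) (fun h => hw (dotProduct_self_eq_zero.mp h.symm))
  set nu : X → ℝ := fun x => Real.sqrt (Au x ⬝ᵥ Au x) with hnudef
  set nv : Y → ℝ := fun y => Real.sqrt (Bv y ⬝ᵥ Bv y) with hnvdef
  have hnu : ∀ x, 0 < nu x := fun x => Real.sqrt_pos.mpr (hpos _ (hAune x))
  have hnv : ∀ y, 0 < nv y := fun y => Real.sqrt_pos.mpr (hpos _ (hBvne y))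
  set uu : X → Fin k → ℝ := fun x => (nu x)⁻¹ • Au x with huudef
  set vv : Y → Fin k → ℝ := fun y => (nv y)⁻¹ • Bv y with hvvdef
  -- their properties
  have hsum_sq : ∀ w : Fin k → ℝ, ∑ l, w l ^ 2 = w ⬝ᵥ w := fun w =>
    Finset.sum_congr rfl fun l _ => sq (w l)
  have huu1 : ∀ x, ∑ l, uu x l ^ 2 = 1 := by
    intro x
    rw [hsum_sq]
    simp only [huudef, smul_dotProduct, dotProduct_smul, smul_eq_mul]
    rw [← Real.sq_sqrt (hnn (Au x))]
    change (nu x)⁻¹ * ((nu x)⁻¹ * nu x ^ 2) = 1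
    field_simp [(hnu x).ne']
  have hvv1 : ∀ y, ∑ l, vv y l ^ 2 = 1 := by
    intro y
    rw [hsum_sq]
    simp only [hvvdef, smul_dotProduct, dotProduct_smul, smul_eq_mul]
    rw [← Real.sq_sqrt (hnn (Bv y))]
    change (nv y)⁻¹ * ((nv y)⁻¹ * nv y ^ 2) = 1
    field_simp [(hnv y).ne']
  have hdot : ∀ x y, ∑ l, uu x l * vv y l = (nu x)⁻¹ * (nv y)⁻¹ * ∑ l, u' x l * v y l := by
    intro x y
    rw [← hkey x y]
    change uu x ⬝ᵥ vv y = _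
    simp only [huudef, hvvdef, smul_dotProduct, dotProduct_smul, smul_eq_mul]
    ring
  have hsign'' : ∀ x y, 0 < M x y * ∑ l, uu x l * vv y l := by
    intro x y
    rw [hdot, show M x y * ((nu x)⁻¹ * (nv y)⁻¹ * ∑ l, u' x l * v y l) =
      ((nu x)⁻¹ * (nv y)⁻¹) * (M x y * ∑ l, u' x l * v y l) by ring]
    exact mul_pos (mul_pos (inv_pos.mpr (hnu x)) (inv_pos.mpr (hnv y))) (hsign' x y)
  have hiso' : ∀ w : Fin k → ℝ, ∑ x, (∑ l, uu x l * w l) ^ 2 =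
      (Fintype.card X : ℝ) / (Fintype.card (Fin k) : ℝ) * ∑ l, w l ^ 2 := by
    intro w
    rw [Fintype.card_fin, hsum_sq w, ← hiso w]
    refine Finset.sum_congr rfl fun x _ => ?_
    change (uu x ⬝ᵥ w) ^ 2 = _
    simp only [huudef, smul_dotProduct, smul_eq_mul]
    rw [mul_pow, ← Real.sq_sqrt (hnn (Au x)), inv_pow]
    change (nu x ^ 2)⁻¹ * (Au x ⬝ᵥ w) ^ 2 = (Au x ⬝ᵥ w) ^ 2 / nu x ^ 2
    rw [div_eq_mul_inv, mul_comm]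
  -- the count
  have hcount := forster_count M uu vv hM hsign'' hB huu1 hvv1 hiso'
  rw [Fintype.card_fin] at hcount
  -- `√(|X||Y|) ≤ √(B² k²) = B k`
  calc Real.sqrt ((Fintype.card X : ℝ) * (Fintype.card Y : ℝ))
      ≤ Real.sqrt (B ^ 2 * (k : ℝ) ^ 2) := Real.sqrt_le_sqrt hcount
    _ = B * k := by rw [← mul_pow, Real.sqrt_sq (by positivity)]

/-- **Forster's Theorem 2.2 from his Theorem 4.1**, general coordinate index type `ι` (reindex by
`Fin |ι|` and apply `halfspaceBound_fin_of_isotropicPosition`).  The conclusion is, verbatim, the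
body of the named fact `Literature.Computability.Complexity.ForsterHalfspaceBound` (Forster's
Theorem 2.2), which is thereby reduced to `ForsterIsotropicPosition` (his Theorem 4.1).
[cite: Forster2002, Theorem 2.2] -/
theorem halfspaceBound_of_isotropicPosition (hI : Literature.Computability.Complexity.ForsterIsotropicPosition) :
    ∀ (X Y ι : Type) [Fintype X] [Fintype Y] [Fintype ι]
      (M : X → Y → ℝ) (u : X → ι → ℝ) (v : Y → ι → ℝ) (B : ℝ),
      0 ≤ B →
      (∀ x y, M x y = 1 ∨ M x y = -1) →
      (∀ x y, 0 < M x y * ∑ l, u x l * v y l) →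
      (∀ (a : X → ℝ) (b : Y → ℝ),
        |∑ x, ∑ y, a x * M x y * b y| ≤ B * Real.sqrt (∑ x, a x ^ 2) * Real.sqrt (∑ y, b y ^ 2)) →
      Real.sqrt ((Fintype.card X : ℝ) * (Fintype.card Y : ℝ)) ≤ B * (Fintype.card ι : ℝ) := by
  intro X Y ι _ _ _ M u v B hB0 hM hsign hB
  classical
  set k := Fintype.card ι with hk
  let e : ι ≃ Fin k := Fintype.equivFin ι
  let u₁ : X → Fin k → ℝ := fun x l => u x (e.symm l)
  let v₁ : Y → Fin k → ℝ := fun y l => v y (e.symm l)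
  have hsum : ∀ x y, ∑ l, u₁ x l * v₁ y l = ∑ l, u x l * v y l := by
    intro x y
    exact Equiv.sum_comp e.symm (fun l => u x l * v y l)
  have hsign₁ : ∀ x y, 0 < M x y * ∑ l, u₁ x l * v₁ y l := by
    intro x y; rw [hsum]; exact hsign x y
  exact halfspaceBound_fin_of_isotropicPosition hI M u₁ v₁ hB0 hM hsign₁ hB

end Summit.QuantumAdvantage.QuantumAdvantage.Theorems.HankelLift.Forster
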